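import Summits.NavierStokesRegularity.NavierStokesRegularity.Theorems.ScaledTopAlignmentTypeIZoomAtPoints
import Literature.Analysis.FluidPDE.AxisymQuotientRayAverage
import Literature.Analysis.FluidPDE.TaoLocalisationHolds
import HarnessLib

/-!
# Route `ScaledTopAlignment`, crux W3ᵐᵗ = `AprioriMostTimesBulkAlignment` (stmt-NavierStokesRegularity-19551),
# registered line `nearmax` (open stub `stub_nearMaxMostTimes`): the TYPE-I BLOW-UP PORTRAIT in the BUDGET
# currency — near a Type-I singular time EVERY rate-near-maximal vorticity window is UNIFORMLY budget-decoherent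

Flow-side transfer of the profile theorem `typeIAncientMild_uniform_window_budget_decoherence`
(`ScaledTopAlignmentTypeIProfileUniformBudgetDecoherence`, the budget form Q(C) of the cell planner's SPLIT-9) to the
Navier–Stokes flow itself, at CALLER-CHOSEN points. Let `(u, p)` be a classical solution on `ℝ³ × [0, T)`
(viscosity `ν > 0`), Leray–Hopf from a rapidly decaying datum, with the Type-I rate at `T`. Write `ω = curl u`,
`ξ = ω/|ω|`, `ℓ(t,x) = √(ν/|ω(t,x)|)` and, for `λ₀ < 1`, `R₀ > 0`, let
`S(t,x) = {y : λ₀|ω(t,x)| ≤ |ω(t,y)|, |y − x| ≤ R₀ ℓ(t,x)}` be the near-max parabolic window — the window of the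
door W3ⁿᵐ / W3ᵐᵗ and of the planner's law UDW (`Law10-rev2.lean`: `windowBudget`, `windowSat`, `satDensity`).

* **`typeI_uniform_window_budget_decoherence`** — for every rate floor `κ > 0` and every `λ₀ < 1`, `R₀ > 0`
  there are `δ > 0` and `t₁ < T` such that at EVERY point `(t, x)`, `t ∈ [t₁, T)`, with
  `κ/(T − t) ≤ |ω(t, x)|`, the `a = 3/2` direction budget of the window beats `δ` times its saturation:
  `δ · ∫_{S(t,x)} |ω|^{5/2}/ν < ∫_{S(t,x)} |ω|^{3/2} ‖∇ξ‖²`.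
  Proof: violating points `(t_j, x_j)`, `t_j → T`, with budget `≤ sat/(j+1)`; the Type-I zoom at THESE points
  (`typeIZoom_vorticity_at_points`: `C²_loc` on the velocity, hence locally uniform convergence of the rescaled
  vorticities `ω̃_j(y) = (λ_j²/ν) ω(t_j, x_j + λ_j y)` and pointwise convergence of their gradients) has a limit
  `W ∈ IsTypeIAncientMild C` with `κ ≤ |curl W(−1)(0)|` (the rate floor is scale invariant); the violation is
  zoom invariant (`budget_le_sat_zoom`, `preimage_window_zoom`); a ball `B(0, r)` lies inside every late zoomed
  window, the zoomed saturations are bounded there, so FATOU (`lintegral_liminf_le'`) gives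
  `∫_{B(0,r)} |curl W(−1)|^{3/2} ‖∇ξ_W‖² = 0`; but the profile theorem, applied to `W` with the window radius
  `R₀' = (r/2)√|curl W(−1)(0)|` (a window inside `B(0, r)`), demands a POSITIVE multiple of the saturation
  STRICTLY below this zero budget — absurd.
  No singularity hypothesis is needed (`¬ HasSmoothExtensionPast` is idle: at a regular `T` the rate floor
  `κ/(T − t) ≤ |ω|` is eventually void).

Consequence for the line `nearmax` / the LAW-M package (nsreg-p3 ROUND-10): the Form-M glue «δ-good rate points
at late times for every δ ⇒ no Type-I blow-up» is now ONE application of this theorem (file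
`…AprioriMostTimesBulkAlignmentNearMaxOfUniversalLaws`); what remains of `stub_alignedProfile_of_lawM` is the
SELECTION of late good rate points from the law UDW∞. WHAT THIS IS NOT: not NS regularity, not a statement about
Type-II blow-up, not a proof of the stub: a necessary condition on hypothetical Type-I singular windows (under the
route's residual NoTypeII every first singularity is of this kind). [folklore]

## References
* G. Koch, N. Nadirashvili, G. Seregin, V. Šverák, Acta Math. 203 (2009) 83–105 = arXiv:0709.3599, Prop. 4.1,
  Lemma 6.1, proof of Thm 6.2 (pp. 8, 11–13). [KochNadirashviliSereginSverak2009]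
* Y. Giga, H. Miura, Comm. Math. Phys. 303 (2011) 289–300, §2 (blow-up sequence, continuous alignment).
  [GigaMiura2011]
-/

noncomputable section

-- the summit and its single sub-problem share the name (CONVENTIONS §1), as in every Theorems file
set_option linter.dupNamespace false

open Set Function Filter Topology Metric MeasureTheory
open scoped RealInnerProductSpace ENNReal NNReal
open Literature.Analysis Literature.Analysis.FluidPDE

namespace Summit.NavierStokesRegularity.NavierStokesRegularity.Theorems

/-! ### Sub-slab bounds of all derivatives (Tao's class), route-file independent -/

/-- **All spatial derivatives are bounded on closed sub-slabs.** For a classical solution (`ν > 0`) on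
`ℝ³ × [0, T)`, Leray–Hopf from its rapidly decaying datum, and `0 < T' < T`: every `Dⁿu` is bounded on
`[0, T'] × ℝ³` (energy `≤ 2E(u 0)` by Leray–Hopf, Tao 2013 bounded Sobolev norms on the CLOSED slab
`tao2011_hasBoundedSobolevNormsOn_holds`, Sobolev imbedding `HasBoundedSobolevNormsOn.exists_forall_norm_iteratedFDeriv_le`).
Stated here free of any route-file import. [cite: Tao2011, Cor. 11.1 + Cor. 4.3 + Thm. 5.4 (iv)] -/
theorem iteratedFDeriv_slab_bound_of_lerayHopf {ν T : ℝ} (hν : 0 < ν)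
    {u : ℝ → EuclideanSpace ℝ (Fin 3) → EuclideanSpace ℝ (Fin 3)} {p : ℝ → EuclideanSpace ℝ (Fin 3) → ℝ}
    (hsol : IsClassicalNSSolutionOn (Ico 0 T) ν 0 u p) (hLH : IsLerayHopfOn T ν 0 (u 0) u)
    (hdec : HasRapidSpatialDecay (u 0)) {T' : ℝ} (hT' : T' ∈ Ioo 0 T) (n : ℕ) :
    ∃ B : ℝ, 0 ≤ B ∧ ∀ t ∈ Icc 0 T', ∀ x, ‖iteratedFDeriv ℝ n (u t) x‖ ≤ B := by
  have hsolc : IsClassicalNSSolutionOn (Icc 0 T') ν 0 u p :=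
    hsol.mono (Icc_subset_Ico_right hT'.2) (uniqueDiffOn_Icc hT'.1)
  have hE : ∃ C : ℝ≥0, ∀ t ∈ Icc 0 T', ∫⁻ x, ‖u t x‖ₑ ^ 2 ≤ C :=
    ⟨(2 * VectorCalculus.kineticEnergy (u 0)).toNNReal, fun t ht =>
      hLH.lintegral_enorm_sq_le hν.le ⟨ht.1, ht.2.trans hT'.2.le⟩⟩
  have hB : HasBoundedSobolevNormsOn (Icc 0 T') u :=
    tao2011_hasBoundedSobolevNormsOn_holds hν hT'.1 hsolc hE hdec
  exact hB.exists_forall_norm_iteratedFDeriv_le (fun t ht => hsolc.contDiff_velocity ht) n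

/-! ### Uniform budget-decoherence of rate-near-maximal windows near a Type-I singular time -/

/-- **Type-I blow-up portrait, budget currency: every rate-near-maximal window is uniformly budget-decoherent.**
For `ν > 0`, `T > 0`, a classical solution `(u, p)` on `ℝ³ × [0, T)`, Leray–Hopf from its rapidly decaying datum
`u 0`, with the Type-I rate at `T`, and for every `κ > 0`, `λ₀ < 1`, `R₀ > 0`: there are `δ > 0` and
`t₁ ∈ [0, T)` such that for all `t ∈ [t₁, T)` and all `x` with `κ/(T − t) ≤ |ω(t,x)|`, on the window
`S = {y : λ₀|ω(t,x)| ≤ |ω(t,y)|, |y − x| ≤ R₀ √(ν/|ω(t,x)|)}` one has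
`δ · ∫_S |ω|^{5/2}/ν < ∫_S |ω|^{3/2} ‖D(ω/|ω|)‖²` (`ω = curl u(t)`). Zoom at the violating points
(`typeIZoom_vorticity_at_points`), zoom invariance of the ratio (`budget_le_sat_zoom`), Fatou on a ball inside
every late window, and the profile theorem `typeIAncientMild_uniform_window_budget_decoherence` (module
docstring). [cite: KochNadirashviliSereginSverak2009, Prop. 4.1 and Lemma 6.1 (arXiv:0709.3599 pp. 8, 11); GigaMiura2011, §2] -/
theorem typeI_uniform_window_budget_decoherence {ν T : ℝ} (hν : 0 < ν) (hT : 0 < T)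
    {u : ℝ → EuclideanSpace ℝ (Fin 3) → EuclideanSpace ℝ (Fin 3)} {p : ℝ → EuclideanSpace ℝ (Fin 3) → ℝ}
    (hsol : IsClassicalNSSolutionOn (Ico 0 T) ν 0 u p) (hLH : IsLerayHopfOn T ν 0 (u 0) u)
    (hdec : HasRapidSpatialDecay (u 0)) (hI : IsTypeIBlowup u T)
    {κ lam0 R0 : ℝ} (hκ : 0 < κ) (hlam1 : lam0 < 1) (hR0 : 0 < R0) :
    ∃ δ : ℝ, 0 < δ ∧ ∃ t₁ ∈ Ico 0 T, ∀ t ∈ Ico t₁ T, ∀ x : EuclideanSpace ℝ (Fin 3),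
      κ / (T - t) ≤ ‖curl (u t) x‖ →
        ENNReal.ofReal δ *
          (∫⁻ y in {y : EuclideanSpace ℝ (Fin 3) | lam0 * ‖curl (u t) x‖ ≤ ‖curl (u t) y‖ ∧
              ‖y - x‖ ≤ R0 * Real.sqrt (ν / ‖curl (u t) x‖)}, ENNReal.ofReal (‖curl (u t) y‖ ^ (5 / 2 : ℝ) / ν)) <
        ∫⁻ y in {y : EuclideanSpace ℝ (Fin 3) | lam0 * ‖curl (u t) x‖ ≤ ‖curl (u t) y‖ ∧
              ‖y - x‖ ≤ R0 * Real.sqrt (ν / ‖curl (u t) x‖)},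
            ENNReal.ofReal (‖curl (u t) y‖ ^ (3 / 2 : ℝ) *
              ‖fderiv ℝ (vorticityDirection (curl (u t))) y‖ ^ 2) := by
  by_contra hcon
  push Not at hcon
  -- ## violating rate points at every level `1/(n+1)`, at times `≥ T - T/(n+2)`
  set τ₀ : ℕ → ℝ := fun n => T - T / ((n : ℝ) + 2) with hτ₀def
  have hτ₀ : ∀ n, τ₀ n ∈ Ico 0 T := fun n => by
    have h2 : (0 : ℝ) < (n : ℝ) + 2 := by positivity
    have h3 : T / ((n : ℝ) + 2) ≤ T := by
      rw [div_le_iff₀ h2]; nlinarith [(Nat.cast_nonneg n : (0 : ℝ) ≤ n)]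
    have h4 : 0 < T / ((n : ℝ) + 2) := div_pos hT h2
    simp only [hτ₀def, mem_Ico]
    constructor <;> linarith
  choose t ht x hx hle using fun n : ℕ => hcon (1 / ((n : ℝ) + 1)) (by positivity) (τ₀ n) (hτ₀ n)
  have htI : ∀ n, t n ∈ Ico 0 T := fun n => ⟨(hτ₀ n).1.trans (ht n).1, (ht n).2⟩
  have hTt : ∀ n, 0 < T - t n := fun n => sub_pos.2 (ht n).2
  have htT : Tendsto t atTop (𝓝 T) := by
    have h0 : Tendsto τ₀ atTop (𝓝 T) := by
      have h1 : Tendsto (fun n : ℕ => T / ((n : ℝ) + 2)) atTop (𝓝 0) := by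
        have h := tendsto_const_div_atTop_nhds_zero_nat T
        have h' : Tendsto (fun n : ℕ => T / ((↑(n + 2) : ℝ))) atTop (𝓝 0) :=
          h.comp (tendsto_add_atTop_nat 2)
        refine h'.congr fun n => ?_
        push_cast; ring_nf
      have := h1.const_sub T
      simpa only [hτ₀def, sub_zero] using this
    refine tendsto_of_tendsto_of_tendsto_of_le_of_le h0 tendsto_const_nhds (fun n => (ht n).1)
      fun n => (ht n).2.le
  -- the flow windows are measurable; the centres carry non-zero vorticity
  have hcurlsm : ∀ n, ContDiff ℝ (⊤ : ℕ∞) (curl (u (t n))) := fun n =>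
    contDiff_curl (n := ⊤) (by exact_mod_cast hsol.contDiff_velocity (htI n))
  have hcurlc : ∀ n, Continuous (curl (u (t n))) := fun n => (hcurlsm n).continuous
  have hxne : ∀ n, curl (u (t n)) (x n) ≠ 0 := fun n => by
    have h : 0 < κ / (T - t n) := div_pos hκ (hTt n)
    exact norm_pos_iff.1 (h.trans_le (hx n))
  have hSflow : ∀ n, MeasurableSet {y : EuclideanSpace ℝ (Fin 3) |
      lam0 * ‖curl (u (t n)) (x n)‖ ≤ ‖curl (u (t n)) y‖ ∧
        ‖y - x n‖ ≤ R0 * Real.sqrt (ν / ‖curl (u (t n)) (x n)‖)} := fun n =>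
    (isClosed_le continuous_const (hcurlc n).norm).measurableSet.inter
      (isClosed_le (continuous_id.sub continuous_const).norm continuous_const).measurableSet
  -- ## the Type-I zoom at the violating points
  have hslab : ∀ T' < T, ∃ M : ℝ, ∀ s ∈ Icc 0 T', ∀ y, ‖u s y‖ ≤ M := by
    have key : ∀ T' ∈ Ioo 0 T, ∃ M : ℝ, ∀ s ∈ Icc 0 T', ∀ y, ‖u s y‖ ≤ M := fun T' hT' => by
      obtain ⟨B, -, hB⟩ := iteratedFDeriv_slab_bound_of_lerayHopf hν hsol hLH hdec hT' 0
      exact ⟨B, fun s hs y => by simpa only [norm_iteratedFDeriv_zero] using hB s hs y⟩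
    intro T' hT'
    by_cases h : 0 < T'
    · exact key T' ⟨h, hT'⟩
    · obtain ⟨M, hM⟩ := key (T / 2) ⟨by linarith, by linarith⟩
      push Not at h
      exact ⟨M, fun s hs y => hM s ⟨hs.1, by linarith [hs.2]⟩ y⟩
  obtain ⟨φ, hφ, C, W, lam, hW, hlam, hlam2, -, hslice, hlu, hD⟩ :=
    typeIZoom_vorticity_at_points hν hT hsol hLH hslab hI htI htT x
  have hφt : Tendsto φ atTop atTop := hφ.tendsto_atTop
  -- the zoomed vorticities at slice `-1` (= time `t (φ j)`), their windows and densities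
  set ωZ : ℕ → EuclideanSpace ℝ (Fin 3) → EuclideanSpace ℝ (Fin 3) := fun j y =>
    (lam j ^ 2 / ν) • curl (u (t (φ j))) (x (φ j) + lam j • y) with hωZ
  set SZ : ℕ → Set (EuclideanSpace ℝ (Fin 3)) := fun j =>
    {y : EuclideanSpace ℝ (Fin 3) | lam0 * ‖ωZ j 0‖ ≤ ‖ωZ j y‖ ∧ ‖y - 0‖ ≤ R0 / Real.sqrt ‖ωZ j 0‖} with hSZ
  set decZ : ℕ → EuclideanSpace ℝ (Fin 3) → ℝ≥0∞ := fun j y =>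
    ENNReal.ofReal (‖ωZ j y‖ ^ (3 / 2 : ℝ) * ‖fderiv ℝ (vorticityDirection (ωZ j)) y‖ ^ 2) with hdecZ
  set satZ : ℕ → EuclideanSpace ℝ (Fin 3) → ℝ≥0∞ := fun j y => ENNReal.ofReal (‖ωZ j y‖ ^ (5 / 2 : ℝ))
    with hsatZ
  have hωZc : ∀ j, Continuous (ωZ j) := fun j => by
    have hc := hcurlc (φ j)
    show Continuous fun y => (lam j ^ 2 / ν) • curl (u (t (φ j))) (x (φ j) + lam j • y)
    fun_prop
  have hωZd : ∀ j, Differentiable ℝ (ωZ j) := fun j => by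
    have hd : Differentiable ℝ (curl (u (t (φ j)))) := (hcurlsm (φ j)).differentiable (by simp)
    show Differentiable ℝ fun y => (lam j ^ 2 / ν) • curl (u (t (φ j))) (x (φ j) + lam j • y)
    fun_prop
  have hSZ_meas : ∀ j, MeasurableSet (SZ j) := fun j =>
    (isClosed_le continuous_const (hωZc j).norm).measurableSet.inter
      (isClosed_le (continuous_id.sub continuous_const).norm continuous_const).measurableSet
  have hdec_meas : ∀ j, Measurable (decZ j) := fun j => measurable_budgetDensity (hωZc j)
  -- the centre of the zoomed window: `ω̃_j(0) = (λ_j²/ν) ω(t, x)`, of size `≥ κ` (rate floor, scale invariant)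
  have hωZ0 : ∀ j, ωZ j 0 = (lam j ^ 2 / ν) • curl (u (t (φ j))) (x (φ j)) := fun j => by
    simp only [hωZ, smul_zero, add_zero]
  have hκZ : ∀ j, κ ≤ ‖ωZ j 0‖ := fun j => by
    rw [hωZ0, norm_smul, Real.norm_of_nonneg (by positivity : (0 : ℝ) ≤ lam j ^ 2 / ν), hlam2 j]
    have hTt' := hTt (φ j)
    have h1 : ν * (T - t (φ j)) / ν * (κ / (T - t (φ j))) = κ := by field_simp
    calc κ = ν * (T - t (φ j)) / ν * (κ / (T - t (φ j))) := h1.symm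
      _ ≤ ν * (T - t (φ j)) / ν * ‖curl (u (t (φ j))) (x (φ j))‖ :=
          mul_le_mul_of_nonneg_left (hx (φ j)) (by positivity)
  -- ## the violation is zoom invariant: budget ≤ saturation/(φ j + 1) on the zoomed windows
  have hle' : ∀ j, ∫⁻ y in SZ j, decZ j y ≤ ENNReal.ofReal (1 / ((φ j : ℝ) + 1)) * ∫⁻ y in SZ j, satZ j y := by
    intro j
    have h1 := budget_le_sat_zoom (ω := curl (u (t (φ j)))) (a := lam j ^ 2 / ν) hν (hlam j) rfl (x (φ j))
      (hSflow (φ j)) (hle (φ j))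
    rw [preimage_window_zoom hν (hlam j) rfl (hxne (φ j)) lam0 R0] at h1
    simpa only [hSZ, hdecZ, hsatZ, hωZ, smul_zero, add_zero] using h1
  -- ## convergence of the zoomed vorticities at slice `-1`
  have hWcsm : ContDiff ℝ (⊤ : ℕ∞) (curl (W (-1))) := contDiff_curl_slice_of_isTypeIAncientMild hW (by norm_num)
  have hWc : Continuous (curl (W (-1))) := hWcsm.continuous
  have hWcd : Differentiable ℝ (curl (W (-1))) := hWcsm.differentiable (by simp)
  have hluω : TendstoLocallyUniformly ωZ (curl (W (-1))) atTop := by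
    have h := hlu (-1) (by norm_num)
    simp only [hslice] at h
    exact h
  have hω : ∀ y, Tendsto (fun j => ωZ j y) atTop (𝓝 (curl (W (-1)) y)) := fun y =>
    hluω.tendstoLocallyUniformlyOn.tendsto_at (mem_univ y)
  have hDω : ∀ y, Tendsto (fun j => fderiv ℝ (ωZ j) y) atTop (𝓝 (fderiv ℝ (curl (W (-1))) y)) := by
    intro y
    have h := hD (-1) (by norm_num) y
    simp only [hslice] at h
    exact h
  -- the limit amplitude at the origin
  set a : EuclideanSpace ℝ (Fin 3) := curl (W (-1)) 0 with ha
  have hκa : κ ≤ ‖a‖ := ge_of_tendsto (hω 0).norm (Eventually.of_forall fun j => hκZ j)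
  have hapos : 0 < ‖a‖ := hκ.trans_le hκa
  have ha0 : a ≠ 0 := norm_pos_iff.1 hapos
  -- ## a ball around the origin inside every late zoomed window
  set lam' : ℝ := max lam0 0 with hlam'
  have hlam'1 : lam' < 1 := max_lt hlam1 one_pos
  have hlam'0 : 0 ≤ lam' := le_max_right _ _
  set m : ℝ := (1 - lam') / 2 * ‖a‖ with hm
  have hm0 : 0 < m := by
    have : 0 < 1 - lam' := by linarith
    positivity
  obtain ⟨r₁, hr₁, hr₁'⟩ : ∃ r₁ > 0, ∀ y : EuclideanSpace ℝ (Fin 3), ‖y‖ < r₁ → ‖curl (W (-1)) y - a‖ < m := by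
    obtain ⟨δ, hδ, h⟩ := Metric.continuousAt_iff.1 (hWc.continuousAt (x := 0)) m hm0
    refine ⟨δ, hδ, fun y hy => ?_⟩
    have := h (by rwa [dist_zero_right])
    rwa [dist_eq_norm] at this
  set r : ℝ := min r₁ (R0 / Real.sqrt (2 * ‖a‖)) with hr
  have hr0 : 0 < r := lt_min hr₁ (by positivity)
  have hball : ∀ y : EuclideanSpace ℝ (Fin 3), ‖y‖ < r →
      curl (W (-1)) y ≠ 0 ∧ lam0 * ‖a‖ + m < ‖curl (W (-1)) y‖ := by
    intro y hy
    have hy1 : ‖y‖ < r₁ := lt_of_lt_of_le hy (min_le_left _ _)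
    have hclose := hr₁' y hy1
    have hlow : ‖a‖ - m < ‖curl (W (-1)) y‖ := by
      have := norm_sub_norm_le a (curl (W (-1)) y)
      rw [norm_sub_rev] at hclose
      linarith
    have h1 : lam0 * ‖a‖ ≤ lam' * ‖a‖ := mul_le_mul_of_nonneg_right (le_max_left _ _) hapos.le
    have h2 : lam' * ‖a‖ + m ≤ ‖a‖ - m := by rw [hm]; nlinarith
    have hpos : 0 < ‖curl (W (-1)) y‖ := by
      have h3 : 0 ≤ lam' * ‖a‖ := mul_nonneg hlam'0 hapos.le
      linarith
    exact ⟨norm_pos_iff.1 hpos, by linarith⟩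
  have hmem : ∀ y : EuclideanSpace ℝ (Fin 3), ‖y‖ < r → ∀ᶠ j in atTop, y ∈ SZ j := by
    intro y hy
    obtain ⟨-, hlev⟩ := hball y hy
    have hn0 : Tendsto (fun j => ‖ωZ j 0‖) atTop (𝓝 ‖a‖) := (hω 0).norm
    have hny : Tendsto (fun j => ‖ωZ j y‖) atTop (𝓝 ‖curl (W (-1)) y‖) := (hω y).norm
    have e1 : ∀ᶠ j in atTop, ‖ωZ j 0‖ < 2 * ‖a‖ := hn0.eventually_lt_const (by linarith)
    have e2 : ∀ᶠ j in atTop, 0 < ‖ωZ j y‖ - lam0 * ‖ωZ j 0‖ :=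
      (hny.sub (hn0.const_mul lam0)).eventually_const_lt (by linarith)
    have e3 : ∀ᶠ j in atTop, ‖a‖ / 2 < ‖ωZ j 0‖ := hn0.eventually_const_lt (by linarith)
    filter_upwards [e1, e2, e3] with j h1 h2 h3
    have hcen : 0 < ‖ωZ j 0‖ := by linarith
    refine ⟨by linarith, ?_⟩
    rw [sub_zero]
    have hy2 : ‖y‖ < R0 / Real.sqrt (2 * ‖a‖) := lt_of_lt_of_le hy (min_le_right _ _)
    have hmono : R0 / Real.sqrt (2 * ‖a‖) ≤ R0 / Real.sqrt ‖ωZ j 0‖ :=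
      div_le_div_of_nonneg_left hR0.le (Real.sqrt_pos.2 hcen) (Real.sqrt_le_sqrt h1.le)
    linarith
  -- ## a uniform bound for the late zoomed vorticities on a fixed compact ball, hence for the saturations
  set R : ℝ := R0 / Real.sqrt (‖a‖ / 2) with hR
  obtain ⟨M₀, hM₀⟩ := (isCompact_closedBall (0 : EuclideanSpace ℝ (Fin 3)) R).exists_bound_of_continuousOn
    hWc.continuousOn
  have hM₀0 : 0 ≤ M₀ := (norm_nonneg _).trans (hM₀ 0 (mem_closedBall_self (by positivity)))
  set M : ℝ := M₀ + 1 with hM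
  have hMpos : 0 < M := by linarith
  have hunif : ∀ᶠ j in atTop, ∀ y ∈ closedBall (0 : EuclideanSpace ℝ (Fin 3)) R,
      dist (curl (W (-1)) y) (ωZ j y) < 1 :=
    Metric.tendstoUniformlyOn_iff.1
      ((tendstoLocallyUniformly_iff_forall_isCompact.1 hluω) _ (isCompact_closedBall 0 R)) 1 one_pos
  set Z : ℝ≥0∞ := ENNReal.ofReal (M ^ (5 / 2 : ℝ)) *
    volume (closedBall (0 : EuclideanSpace ℝ (Fin 3)) R) with hZ
  have hZtop : Z ≠ ⊤ := ENNReal.mul_ne_top ENNReal.ofReal_ne_top measure_closedBall_lt_top.ne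
  have hsat : ∀ᶠ j in atTop, ∫⁻ y in SZ j, satZ j y ≤ Z := by
    have e3 : ∀ᶠ j in atTop, ‖a‖ / 2 < ‖ωZ j 0‖ := (hω 0).norm.eventually_const_lt (by linarith)
    filter_upwards [hunif, e3] with j hj h3
    have hsub : SZ j ⊆ closedBall (0 : EuclideanSpace ℝ (Fin 3)) R := fun y hy => by
      rw [mem_closedBall, dist_eq_norm]
      refine hy.2.trans ?_
      exact div_le_div_of_nonneg_left hR0.le (Real.sqrt_pos.2 (by positivity)) (Real.sqrt_le_sqrt h3.le)
    have hbd : ∀ y ∈ SZ j, satZ j y ≤ ENNReal.ofReal (M ^ (5 / 2 : ℝ)) := fun y hy => by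
      have hyR : y ∈ closedBall (0 : EuclideanSpace ℝ (Fin 3)) R := hsub hy
      have hnorm : ‖ωZ j y‖ ≤ M := by
        have hd := hj _ hyR
        rw [dist_eq_norm] at hd
        have := norm_le_norm_add_norm_sub (curl (W (-1)) y) (ωZ j y)
        linarith [hM₀ _ hyR]
      exact ENNReal.ofReal_le_ofReal (Real.rpow_le_rpow (norm_nonneg _) hnorm (by norm_num))
    calc ∫⁻ y in SZ j, satZ j y
        ≤ ∫⁻ y in SZ j, ENNReal.ofReal (M ^ (5 / 2 : ℝ)) := setLIntegral_mono measurable_const hbd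
      _ = ENNReal.ofReal (M ^ (5 / 2 : ℝ)) * volume (SZ j) := setLIntegral_const _ _
      _ ≤ ENNReal.ofReal (M ^ (5 / 2 : ℝ)) * volume (closedBall (0 : EuclideanSpace ℝ (Fin 3)) R) :=
          mul_le_mul_right (measure_mono hsub) _
      _ = Z := by rw [hZ]
  -- ## Fatou on the ball `B(0,r)` for the zoomed budget densities
  set G : ℕ → EuclideanSpace ℝ (Fin 3) → ℝ≥0∞ := fun j y => (SZ j).indicator (decZ j) y with hG
  have hG_meas : ∀ j, Measurable (G j) := fun j => (hdec_meas _).indicator (hSZ_meas _)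
  have hGint : ∀ j, ∫⁻ y, G j y = ∫⁻ y in SZ j, decZ j y := fun j => by
    simp only [hG]
    rw [lintegral_indicator (hSZ_meas _)]
  set b : ℕ → ℝ≥0∞ := fun j => ENNReal.ofReal (1 / ((φ j : ℝ) + 1)) * Z with hb
  have hb0 : Tendsto b atTop (𝓝 0) := by
    have h1 : Tendsto (fun j => ENNReal.ofReal (1 / ((φ j : ℝ) + 1))) atTop (𝓝 0) := by
      rw [← ENNReal.ofReal_zero]
      exact ENNReal.tendsto_ofReal (tendsto_one_div_add_atTop_nhds_zero_nat.comp hφt)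
    have h2 := ENNReal.Tendsto.mul_const h1 (Or.inr hZtop)
    rwa [zero_mul] at h2
  have hGle : ∀ᶠ j in atTop, ∫⁻ y in ball (0 : EuclideanSpace ℝ (Fin 3)) r, G j y ≤ b j := by
    filter_upwards [hsat] with j hj
    calc ∫⁻ y in ball (0 : EuclideanSpace ℝ (Fin 3)) r, G j y ≤ ∫⁻ y, G j y := setLIntegral_le_lintegral _ _
      _ = ∫⁻ y in SZ j, decZ j y := hGint j
      _ ≤ ENNReal.ofReal (1 / ((φ j : ℝ) + 1)) * ∫⁻ y in SZ j, satZ j y := hle' j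
      _ ≤ b j := mul_le_mul_right hj _
  set decW : EuclideanSpace ℝ (Fin 3) → ℝ≥0∞ := fun y =>
    ENNReal.ofReal (‖curl (W (-1)) y‖ ^ (3 / 2 : ℝ) * ‖fderiv ℝ (vorticityDirection (curl (W (-1)))) y‖ ^ 2)
    with hdecW
  have hGlim : ∀ y ∈ ball (0 : EuclideanSpace ℝ (Fin 3)) r, Tendsto (fun j => G j y) atTop (𝓝 (decW y)) := by
    intro y hy
    rw [mem_ball, dist_zero_right] at hy
    obtain ⟨hb0', -⟩ := hball y hy
    have hDξ : Tendsto (fun j => fderiv ℝ (vorticityDirection (ωZ j)) y) atTop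
        (𝓝 (fderiv ℝ (vorticityDirection (curl (W (-1)))) y)) :=
      tendsto_fderiv_vorticityDirection (fun j => (hωZd j) y) (hWcd y) hb0' (hω y) (hDω y)
    have hlimV : Tendsto (fun j => ENNReal.ofReal (‖ωZ j y‖ ^ (3 / 2 : ℝ) *
        ‖fderiv ℝ (vorticityDirection (ωZ j)) y‖ ^ 2)) atTop (𝓝 (decW y)) :=
      ENNReal.tendsto_ofReal ((((hω y).norm).rpow_const (Or.inr (by norm_num))).mul ((hDξ.norm).pow 2))
    refine hlimV.congr' ?_
    filter_upwards [hmem y hy] with j hj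
    simp only [hG]
    rw [indicator_of_mem hj]
  have hFatou : ∫⁻ y in ball (0 : EuclideanSpace ℝ (Fin 3)) r, decW y = 0 := by
    refine le_antisymm ?_ bot_le
    calc ∫⁻ y in ball (0 : EuclideanSpace ℝ (Fin 3)) r, decW y
        = ∫⁻ y in ball (0 : EuclideanSpace ℝ (Fin 3)) r, liminf (fun j => G j y) atTop :=
          setLIntegral_congr_fun measurableSet_ball (fun y hy => ((hGlim y hy).liminf_eq).symm)
      _ ≤ liminf (fun j => ∫⁻ y in ball (0 : EuclideanSpace ℝ (Fin 3)) r, G j y) atTop :=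
          lintegral_liminf_le' fun j => (hG_meas j).aemeasurable
      _ ≤ liminf b atTop := liminf_le_liminf hGle
      _ = 0 := hb0.liminf_eq
  -- ## the profile theorem on a window of the limit inside the ball: a positive quantity below zero
  set R0' : ℝ := r / 2 * Real.sqrt ‖a‖ with hR0'
  have hR0'pos : 0 < R0' := by positivity
  obtain ⟨δ, hδ, hQ⟩ := typeIAncientMild_uniform_window_budget_decoherence (C := C) (κ := κ) (lam0 := lam0)
    (R0 := R0') (s := -1) hκ hlam1 hR0'pos (by norm_num)
  have hQ' := hQ W hW 0 hκa
  have hsub : {y : EuclideanSpace ℝ (Fin 3) | lam0 * ‖curl (W (-1)) 0‖ ≤ ‖curl (W (-1)) y‖ ∧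
      ‖y - 0‖ ≤ R0' / Real.sqrt ‖curl (W (-1)) 0‖} ⊆ ball (0 : EuclideanSpace ℝ (Fin 3)) r := by
    intro y hy
    rw [mem_ball, dist_zero_right]
    have h2 := hy.2
    rw [sub_zero, ← ha, hR0', mul_div_assoc, div_self (Real.sqrt_pos.2 hapos).ne', mul_one] at h2
    linarith
  have hzero : ∫⁻ y in {y : EuclideanSpace ℝ (Fin 3) | lam0 * ‖curl (W (-1)) 0‖ ≤ ‖curl (W (-1)) y‖ ∧
      ‖y - 0‖ ≤ R0' / Real.sqrt ‖curl (W (-1)) 0‖},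
        ENNReal.ofReal (‖curl (W (-1)) y‖ ^ (3 / 2 : ℝ) *
          ‖fderiv ℝ (vorticityDirection (curl (W (-1)))) y‖ ^ 2) = 0 :=
    le_antisymm ((lintegral_mono_set hsub).trans hFatou.le) bot_le
  rw [hzero] at hQ'
  exact ENNReal.not_lt_zero hQ'

end Summit.NavierStokesRegularity.NavierStokesRegularity.Theorems

end
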